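import Summits.HubbardSuperconductivity.HubbardSuperconductivity.Theorems.ThermalWedgeTwSeededEnsembleEquivalenceT0AHM
import Literature.MathematicalPhysics.QuantumLattice.DWaveSourceNNNHopping
import Literature.MathematicalPhysics.QuantumLattice.TorusDiagOutwardNeighbours

/-!
# Bogoliubov Jr.'s approximating-Hamiltonian method for the pair-sourced `t–t'` torus WITH A BASE
# FIELD — 1/2: channel algebra, gauge rotation, graded locality, and the easy half

Cell `hubbard-cq` (venture `CertifiedManyBodySolver`, LADDER rung CQ / row PC). Serves (i) the
transplant lens's finite-`h` dictionary (hubbard-cq-lens-transplant-1, DICTIONARY §12, items (α)(β)(γ):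
the `T = 0` approximating-Hamiltonian bound is step F1-T0 of the proof chain for the pair-LRO CEILING
of translation-invariant sourced ground states) and (ii) the «does-not-give» column of card
`bcs-crutch-odlro-floor` (critic-2 / transplant-1 BN-T1: a crutch word carries no bit beyond the sourced
energy curve) — see the sibling file `SourcedTorusTTPrimeT0AHM.lean` for the hard half and the reading.

Objects (all tree): `A_L(h) = dWaveSourceTorusTT' L t' U μ h` (the grand-canonical `t–t'` Hubbard torus
with the `d`-wave pair source, Koma–Tasaki 1994 §1 / Xu et al. 2024 eq. (1)), `Δ_d = pairField
dWaveFormFactor L`, and the BCS-crutch Hamiltonian WITH BASE FIELD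
`H_{g,L}(h₀) = A_L(h₀) − (g/L²) Δ_dᴴ Δ_d` (at `h₀ = 0` this is `crutchTorusTT' L t' U μ g` of
`Observables/CrutchODLROFloor.lean`, unfolded). In Bogoliubov Jr.'s language: kinetic part `T = A_L(h₀)`,
ONE attractive channel `W = √g Δ_d`, volume `V = L²`, approximating Hamiltonians
`T − (c̄ W + c Wᴴ)`.

Contents (everything PROVED; no definition, no named fact):
* `ahmTT'_model_eq`, `ahmTT'_approx_real_eq`, `ahmTT'_approx_eq` — channel algebra: the model is
  `H_{g,L}(h₀)`; a REAL amplitude `c = (h − h₀)/√g` gives `A_L(h)`; a COMPLEX amplitude `c` gives the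
  complex-sourced torus with total amplitude `z = h₀ + √g c`;
* `ahmTT'_partitionFn_approx_eq` — the constant `U(1)` rotation by `−arg(z)/2` fixes `T_μ` AND the
  diagonal hopping and turns the total amplitude real: `Z_β(T − (c̄W + cWᴴ)) = Z_β(A_L(|h₀ + √g c|))`;
* `ahmTT'_norm_comm_diagHop_localPair_le` / `…_pairField_le`, `ahmTT'_norm_comm_pairField_sourcedTT'_le`
  — graded locality: `‖[Δ_d, A_L(h₀)]‖ ≤ κ(t',U,μ,h₀)·L²` with
  `κ = 45·2(2+|U|+2|μ|)‖P‖ + 45·2(2|t'|)‖P‖ + |h₀|·25·2‖P‖²`, `‖P‖ = 2Σ_e|d(e)/√2|` (the diagonal graph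
  has degree `≤ 4`: the tree's `card_filter_torusDiagGraph_adj_le`, transferred; `[Δ_d, Δ_d] = 0`);
* `ahmTT'_groundEnergy_model_le` — the EASY HALF at `T = 0`, every `L`, `μ`, `h₀`, `h`, `g > 0`:
  `E₀(H_{g,L}(h₀)) ≤ E₀(A_L(h)) + (h − h₀)² L²/g` (completed square, thermal form, entropy sandwich).

Method: the tree's one-channel toolkit (`ApproximatingHamiltonianProofs`) instantiated exactly as in
`ThermalWedgeTwApproximatingHamiltonian{,Gauge,Locality}` / `…T0AHM` (the case `t' = h₀ = 0`), plus
(i) the `t'` hopping through `norm_commutator_hamiltonianWith_le` on `fermionTorusDiagGraph`, (ii) the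
base field's own commutator `h₀[Δ_d, Δ_dᴴ]` through `twAhm_norm_comm_pairField_conjTranspose_le`,
(iii) the phase of the TOTAL amplitude `h₀ + √g c` (not of `c`) removed by the gauge rotation.

HONEST SCOPE / WHAT THIS IS NOT: `H_{g,L}` is the BCS-crutch Hamiltonian, NOT the Hubbard model;
nothing is claimed at `g = 0`; no order-parameter floor, no phase sentence; finite torus only.
Instance convention: the default `DecidableEq (FermionTorus 2 L)` of `DWaveSourceNNNHopping*` (not the
row files' local `LinearOrder.toDecidableEq`; consumers in that convention bridge with `convert`).

References: N. N. Bogolyubov Jr., J. G. Brankov, V. A. Zagrebnov, A. M. Kurbatov, N. S. Tonchev,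
Russ. Math. Surveys 39:6 (1984) 1–50; J.-B. Bru, W. de Siqueira Pedra, Mem. AMS 224 (2013) no. 1052,
Appendix, Theorem 107 with (A1)–(A3); O. Bratteli, D. W. Robinson, *Operator Algebras and Quantum
Statistical Mechanics 2*, §5.2.2 (graded locality); T. Koma, H. Tasaki, PRL 68 (1992) 3248,
eqs. (5)–(8) (gauge rotation); M. B. Hastings, T. Koma, CMP 265 (2006) 781, App. A.
-/

noncomputable section

namespace Summit.Ventures.CertifiedManyBodySolver.Observables.SourcedTorusAHM

open Matrix Finset Filter Topology Literature.MathematicalPhysics.QuantumLattice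
open Literature.Probability.LatticeModels
open Summit.HubbardSuperconductivity.HubbardSuperconductivity.Theorems
open Summit.HubbardSuperconductivity.HubbardSuperconductivity.Theorems.TwSeededEnsembleEquivalence.Negative
open Summit.HubbardSuperconductivity.HubbardSuperconductivity.Theorems.TwSeededEnsembleEquivalence.ExposedDensity
open Summit.HubbardSuperconductivity.HubbardSuperconductivity.Theorems.TwSourcedCondensation.Negative
open scoped ComplexOrder Matrix.Norms.L2Operator ComplexConjugate

section PerTorus

variable (L : ℕ) [NeZero L]

/-! ### Algebra of the channel `W = √g·Δ_d` over the sourced `t–t'` torus -/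

/-- Model identity for ANY kinetic part `T`: `T − (L²)⁻¹·(√gΔ_d)ᴴ(√gΔ_d) = T − (g/L²)·Δ_dᴴΔ_d`.
[folklore] -/
theorem ahmTT'_model_eq
    (T : Matrix (Finset (Orb (FermionTorus 2 L))) (Finset (Orb (FermionTorus 2 L))) ℂ)
    {g : ℝ} (hg : 0 ≤ g) :
    T - ((((L : ℝ) ^ 2)⁻¹ : ℝ) : ℂ) •
        ((((Real.sqrt g : ℝ) : ℂ) • pairField dWaveFormFactor L)ᴴ *
          (((Real.sqrt g : ℝ) : ℂ) • pairField dWaveFormFactor L)) =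
      T - ((g / (L : ℝ) ^ 2 : ℝ) : ℂ) •
        ((pairField dWaveFormFactor L)ᴴ * pairField dWaveFormFactor L) := by
  rw [conjTranspose_smul, Complex.star_def, Complex.conj_ofReal, smul_mul_smul_comm, smul_smul]
  congr 2
  rw [← Complex.ofReal_mul, ← Complex.ofReal_mul, Real.mul_self_sqrt hg]
  push_cast
  ring

/-- With the REAL amplitude `c = (h − h₀)/√g` the approximating Hamiltonian over the base-field
kinetic part `A_L(h₀) = dWaveSourceTorusTT' L tp U μ h₀` is the sourced torus at field `h`:
`A_L(h₀) − (h − h₀)(Δ_d + Δ_dᴴ) = A_L(h)`. [folklore] -/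
theorem ahmTT'_approx_real_eq (tp U μ h₀ h : ℝ) {g : ℝ} (hg : 0 < g) :
    dWaveSourceTorusTT' L tp U μ h₀ -
        (starRingEnd ℂ (((h - h₀) / Real.sqrt g : ℝ) : ℂ) •
            (((Real.sqrt g : ℝ) : ℂ) • pairField dWaveFormFactor L) +
          (((h - h₀) / Real.sqrt g : ℝ) : ℂ) •
            (((Real.sqrt g : ℝ) : ℂ) • pairField dWaveFormFactor L)ᴴ) =
      dWaveSourceTorusTT' L tp U μ h := by
  have hsg : Real.sqrt g ≠ 0 := (Real.sqrt_pos.2 hg).ne'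
  have hsc : (((h - h₀) / Real.sqrt g : ℝ) : ℂ) * ((Real.sqrt g : ℝ) : ℂ) = ((h - h₀ : ℝ) : ℂ) := by
    rw [← Complex.ofReal_mul, div_mul_cancel₀ _ hsg]
  rw [Complex.conj_ofReal, conjTranspose_smul, Complex.star_def, Complex.conj_ofReal, smul_smul,
    smul_smul, hsc, ← smul_add, dWaveSourceTorusTT', dWaveSourceTorusTT', Complex.ofReal_sub,
    sub_smul]
  abel

/-- The approximating Hamiltonian over the base-field kinetic part with a COMPLEX amplitude `c`
is the complex-sourced `t–t'` torus with amplitude `z = h₀ + a c`: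
`A_L(h₀) − (c̄·aΔ_d + c·aΔ_dᴴ) = (T_μ − (z̄ Δ_d + z Δ_dᴴ)) + D_{t'}`, `T_μ = hubbardTorusWith 2 L 1 U μ`,
`D_{t'}` the diagonal hopping term. [folklore] -/
theorem ahmTT'_approx_eq (tp U μ h₀ a : ℝ) (c : ℂ) :
    dWaveSourceTorusTT' L tp U μ h₀ -
        (starRingEnd ℂ c • (((a : ℝ) : ℂ) • pairField dWaveFormFactor L) +
          c • (((a : ℝ) : ℂ) • pairField dWaveFormFactor L)ᴴ) =
      (hubbardTorusWith 2 L 1 U μ -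
          (starRingEnd ℂ ((h₀ : ℂ) + (a : ℂ) * c) • (((1 : ℝ) : ℂ) • pairField dWaveFormFactor L) +
            ((h₀ : ℂ) + (a : ℂ) * c) • (((1 : ℝ) : ℂ) • pairField dWaveFormFactor L)ᴴ)) +
        hamiltonian (fermionTorusDiagGraph L) tp 0 := by
  rw [dWaveSourceTorusTT'_eq_dWaveSourceTorus_add, dWaveSourceTorus]
  simp only [conjTranspose_smul, Complex.star_def, Complex.conj_ofReal, Complex.ofReal_one, map_add,
    map_mul, one_smul]
  module

/-- **The gauge rotation removes the phase**: for every complex amplitude `c`,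
`Z_β(A_L(h₀) − (c̄·aΔ_d + c·aΔ_dᴴ)) = Z_β(A_L(|h₀ + a c|))` (constant `U(1)` rotation by half the
argument of `h₀ + a c`; it fixes `T_μ` and the diagonal hopping). [folklore] -/
theorem ahmTT'_partitionFn_approx_eq (β tp U μ h₀ a : ℝ) (c : ℂ) :
    partitionFn β (dWaveSourceTorusTT' L tp U μ h₀ -
        (starRingEnd ℂ c • (((a : ℝ) : ℂ) • pairField dWaveFormFactor L) +
          c • (((a : ℝ) : ℂ) • pairField dWaveFormFactor L)ᴴ)) =
      partitionFn β (dWaveSourceTorusTT' L tp U μ ‖(h₀ : ℂ) + (a : ℂ) * c‖) := by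
  set z : ℂ := (h₀ : ℂ) + (a : ℂ) * c with hz
  have hconj : phaseGauge (fun _ : FermionTorus 2 L => Circle.exp (-(Complex.arg z) / 2)) *
      (dWaveSourceTorusTT' L tp U μ h₀ -
        (starRingEnd ℂ c • (((a : ℝ) : ℂ) • pairField dWaveFormFactor L) +
          c • (((a : ℝ) : ℂ) • pairField dWaveFormFactor L)ᴴ)) *
      (phaseGauge (fun _ : FermionTorus 2 L => Circle.exp (-(Complex.arg z) / 2)))ᴴ =
      dWaveSourceTorusTT' L tp U μ ‖z‖ := by
    rw [ahmTT'_approx_eq, Matrix.mul_add, Matrix.add_mul,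
      twAhm_phaseGauge_conj_approx L 1 U μ 1 dWaveFormFactor z, phaseGauge_const_conj_hamiltonian,
      mul_one, dWaveSourceTorusTT'_eq_dWaveSourceTorus_add, dWaveSourceTorus]
  have hu := partitionFn_unitary_conj
    (twAhm_phaseGauge_const_mem_unitary L (Circle.exp (-(Complex.arg z) / 2))) β
    (dWaveSourceTorusTT' L tp U μ h₀ -
      (starRingEnd ℂ c • (((a : ℝ) : ℂ) • pairField dWaveFormFactor L) +
        c • (((a : ℝ) : ℂ) • pairField dWaveFormFactor L)ᴴ))
  rw [star_eq_conjTranspose, hconj] at hu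
  exact hu.symm


/-! ### Volume-linear commutator bound `‖[Δ_d, A_L(h₀)]‖ = O(L²)` (graded locality) -/

/-- Degrees of the diagonal (next-nearest-neighbour) graph of the fermionic torus are `≤ 4` —
transfer of the tree's `card_filter_torusDiagGraph_adj_le` along `FermionTorus.equivTorusSite`
(private helper; no new neighbour count is proved here). -/
private theorem ahmTT'_card_filter_diagAdj_le (x : FermionTorus 2 L) :
    (Finset.univ.filter fun y => (fermionTorusDiagGraph L).Adj x y).card ≤ 4 := by
  calc (Finset.univ.filter fun y => (fermionTorusDiagGraph L).Adj x y).card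
      = ((Finset.univ.filter fun y => (fermionTorusDiagGraph L).Adj x y).image
          FermionTorus.toTorusSite).card :=
        (Finset.card_image_of_injective _ FermionTorus.equivTorusSite.injective).symm
    _ ≤ (Finset.univ.filter fun w : TorusSite 2 L =>
          (torusDiagGraph L).Adj (FermionTorus.toTorusSite x) w).card := by
        refine Finset.card_le_card fun w hw => ?_
        obtain ⟨y, hy, rfl⟩ := Finset.mem_image.1 hw
        exact Finset.mem_filter.2 ⟨Finset.mem_univ _, (Finset.mem_filter.1 hy).2⟩
    _ ≤ 4 := card_filter_torusDiagGraph_adj_le (FermionTorus.toTorusSite x)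

/-- **`‖[D_{t'}, P_x]‖ ≤ 45 · 2(2|t'|) · ‖P‖`** for the diagonal hopping term
`D_{t'} = hamiltonian (fermionTorusDiagGraph L) t' 0` and the local pair `P_x` of any form factor
(only the `≤ 5·9` local terms of `D_{t'}` meeting the support of `P_x` survive; `‖P‖ = 2Σ_e|φ e/√2|`).
Hastings–Koma 2006 App. A; Bratteli–Robinson II §5.2.2; the `t'`-twin of
`twAhm_norm_comm_hubbardTorusWith_localPair_le`. -/
theorem ahmTT'_norm_comm_diagHop_localPair_le (tp : ℝ) (φ : Site 2 → ℝ) (x : TorusSite 2 L) :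
    ‖hamiltonian (fermionTorusDiagGraph L) tp 0 * localPair φ L x -
        localPair φ L x * hamiltonian (fermionTorusDiagGraph L) tp 0‖ ≤
      45 * (2 * (2 * |tp|) * (2 * ∑ e ∈ insert (0 : Site 2) unitSteps, |φ e / Real.sqrt 2|)) := by
  have hA := carEvenSubalgebra_le_carSubalgebra _ (twAhm_localPair_mem_carEvenSubalgebra L φ x)
  have h := norm_commutator_hamiltonianWith_le (fermionTorusDiagGraph L) (Δ := 4)
    (ahmTT'_card_filter_diagAdj_le L) tp 0 0 hA
  simp only [hamiltonianWith_zero, abs_zero, add_zero, mul_zero] at h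
  refine h.trans ?_
  have hcard : (((insert (0 : Site 2) unitSteps).image
      fun e => FermionTorus.ofTorusSite (x + Torus.proj L e)).card * (2 * 4 + 1) : ℕ) ≤ 45 := by
    have := twAhm_card_supp_le L x
    omega
  have hP := norm_localPair_le φ L x
  have hnn : 0 ≤ 2 * (2 * |tp|) := by positivity
  exact mul_le_mul (by exact_mod_cast hcard) (mul_le_mul_of_nonneg_left hP hnn) (by positivity)
    (by norm_num)

/-- **`‖[D_{t'}, Δ_φ]‖ ≤ 45 · 2(2|t'|) · ‖P‖ · L²`**: the commutator of the diagonal hopping term with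
the pair field is volume-linear. Hastings–Koma 2006 App. A; `t'`-twin of
`twAhm_norm_comm_hubbardTorusWith_pairField_le`. -/
theorem ahmTT'_norm_comm_diagHop_pairField_le (tp : ℝ) (φ : Site 2 → ℝ) :
    ‖hamiltonian (fermionTorusDiagGraph L) tp 0 * pairField φ L -
        pairField φ L * hamiltonian (fermionTorusDiagGraph L) tp 0‖ ≤
      45 * (2 * (2 * |tp|) * (2 * ∑ e ∈ insert (0 : Site 2) unitSteps, |φ e / Real.sqrt 2|)) *
        (L : ℝ) ^ 2 := by
  have hsum : hamiltonian (fermionTorusDiagGraph L) tp 0 * pairField φ L -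
      pairField φ L * hamiltonian (fermionTorusDiagGraph L) tp 0 =
      ∑ x : TorusSite 2 L, (hamiltonian (fermionTorusDiagGraph L) tp 0 * localPair φ L x -
        localPair φ L x * hamiltonian (fermionTorusDiagGraph L) tp 0) := by
    rw [pairField, Finset.mul_sum, Finset.sum_mul, ← Finset.sum_sub_distrib]
  rw [hsum]
  refine (norm_sum_le _ _).trans ?_
  calc ∑ x : TorusSite 2 L, ‖hamiltonian (fermionTorusDiagGraph L) tp 0 * localPair φ L x -
          localPair φ L x * hamiltonian (fermionTorusDiagGraph L) tp 0‖
      ≤ ∑ _x : TorusSite 2 L, 45 * (2 * (2 * |tp|) *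
          (2 * ∑ e ∈ insert (0 : Site 2) unitSteps, |φ e / Real.sqrt 2|)) :=
        Finset.sum_le_sum fun x _ => ahmTT'_norm_comm_diagHop_localPair_le L tp φ x
    _ = 45 * (2 * (2 * |tp|) * (2 * ∑ e ∈ insert (0 : Site 2) unitSteps, |φ e / Real.sqrt 2|)) *
          (L : ℝ) ^ 2 := by
        rw [Finset.sum_const, card_univ, nsmul_eq_mul, twAhm_card_torusSite]; ring

/-- **`‖[Δ_d, A_L(h₀)]‖ ≤ κ(t', U, μ, h₀) · L²`** with the explicit constant
`κ = 45·2(2 + |U| + 2|μ|)‖P‖ + 45·2(2|t'|)‖P‖ + |h₀|·25·2‖P‖²`, `‖P‖ = 2Σ_e|d(e)/√2|`: the three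
pieces of `A_L(h₀) = T_μ + D_{t'} − h₀(Δ_d + Δ_dᴴ)` are handled by
`twAhm_norm_comm_hubbardTorusWith_pairField_le`, `ahmTT'_norm_comm_diagHop_pairField_le` and
`twAhm_norm_comm_pairField_conjTranspose_le` (`[Δ_d, Δ_d] = 0`). Bratteli–Robinson II §5.2.2. -/
theorem ahmTT'_norm_comm_pairField_sourcedTT'_le (tp U μ h₀ : ℝ) :
    ‖pairField dWaveFormFactor L * dWaveSourceTorusTT' L tp U μ h₀ -
        dWaveSourceTorusTT' L tp U μ h₀ * pairField dWaveFormFactor L‖ ≤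
      (45 * (2 * (2 * |(1 : ℝ)| + |U| + 2 * |μ|) *
            (2 * ∑ e ∈ insert (0 : Site 2) unitSteps, |dWaveFormFactor e / Real.sqrt 2|)) +
          45 * (2 * (2 * |tp|) *
            (2 * ∑ e ∈ insert (0 : Site 2) unitSteps, |dWaveFormFactor e / Real.sqrt 2|)) +
          |h₀| * (25 * (2 *
            (2 * ∑ e ∈ insert (0 : Site 2) unitSteps, |dWaveFormFactor e / Real.sqrt 2|) ^ 2))) *
        (L : ℝ) ^ 2 := by
  set Δ := pairField dWaveFormFactor L with hΔ
  set T₀ := hubbardTorusWith 2 L 1 U μ with hT₀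
  set D := hamiltonian (fermionTorusDiagGraph L) tp 0 with hD
  have hsplit : Δ * dWaveSourceTorusTT' L tp U μ h₀ - dWaveSourceTorusTT' L tp U μ h₀ * Δ =
      -(T₀ * Δ - Δ * T₀) - (D * Δ - Δ * D) - (h₀ : ℂ) • (Δ * Δᴴ - Δᴴ * Δ) := by
    rw [dWaveSourceTorusTT'_eq_dWaveSourceTorus_add, dWaveSourceTorus]
    simp only [Matrix.mul_add, Matrix.add_mul, Matrix.mul_sub, Matrix.sub_mul, Matrix.mul_smul,
      Matrix.smul_mul, smul_sub, smul_add, neg_sub]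
    abel
  rw [hsplit]
  have h1 := twAhm_norm_comm_hubbardTorusWith_pairField_le L 1 U μ dWaveFormFactor
  have h2 := ahmTT'_norm_comm_diagHop_pairField_le L tp dWaveFormFactor
  have h3 := twAhm_norm_comm_pairField_conjTranspose_le L dWaveFormFactor
  calc ‖-(T₀ * Δ - Δ * T₀) - (D * Δ - Δ * D) - (h₀ : ℂ) • (Δ * Δᴴ - Δᴴ * Δ)‖
      ≤ ‖-(T₀ * Δ - Δ * T₀)‖ + ‖D * Δ - Δ * D‖ + ‖(h₀ : ℂ) • (Δ * Δᴴ - Δᴴ * Δ)‖ :=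
        (norm_sub_le _ _).trans (add_le_add (norm_sub_le _ _) le_rfl)
    _ = ‖T₀ * Δ - Δ * T₀‖ + ‖D * Δ - Δ * D‖ + |h₀| * ‖Δ * Δᴴ - Δᴴ * Δ‖ := by
        rw [norm_neg, twAhm_norm_real_smul]
    _ ≤ _ := by
        rw [add_mul, add_mul]
        refine add_le_add (add_le_add h1 h2) ?_
        rw [mul_assoc]
        exact mul_le_mul_of_nonneg_left h3 (abs_nonneg _)


/-! ### The easy half: the completed square, every `L` and every field -/

/-- The base-field crutch Hamiltonian `A_L(h₀) − (g/L²)Δ_dᴴΔ_d` is Hermitian. -/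
theorem ahmTT'_isHermitian_model (tp U μ h₀ g : ℝ) :
    (dWaveSourceTorusTT' L tp U μ h₀ - ((g / (L : ℝ) ^ 2 : ℝ) : ℂ) •
      ((pairField dWaveFormFactor L)ᴴ * pairField dWaveFormFactor L)).IsHermitian :=
  (dWaveSourceTorusTT'_isHermitian L tp U μ h₀).sub (isHermitian_smul_seed L _)

/-- **Easy half of the `T = 0` approximating-Hamiltonian bound with a base field** (every `L`,
`t'`, `U`, `μ`, every base field `h₀`, every field `h`, every `g > 0`):
`E₀(A_L(h₀) − (g/L²)Δ_dᴴΔ_d) ≤ E₀(A_L(h)) + (h − h₀)²L²/g`.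
The completed square `−(g/L²)Δ_dᴴΔ_d ≤ −(h − h₀)(Δ_d + Δ_dᴴ) + ((h − h₀)²L²/g)·1`, in the thermal
form `log_partitionFn_approx_le_model` (amplitude `c = (h − h₀)/√g`), then the entropy sandwich
`−βE₀ ≤ log Z_β ≤ L² log 4 − βE₀` and `β → ∞`. Bru–de Siqueira Pedra (2013), Appendix, Theorem 107
(lower bound); the `t' = h₀ = 0` case is the tree's `t0AHM_groundEnergy_le`. -/
theorem ahmTT'_groundEnergy_model_le (tp U μ h₀ h : ℝ) {g : ℝ} (hg : 0 < g) :
    (dWaveSourceTorusTT' L tp U μ h₀ - ((g / (L : ℝ) ^ 2 : ℝ) : ℂ) •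
        ((pairField dWaveFormFactor L)ᴴ * pairField dWaveFormFactor L)).groundEnergy ≤
      (dWaveSourceTorusTT' L tp U μ h).groundEnergy + (h - h₀) ^ 2 * (L : ℝ) ^ 2 / g := by
  have hT : (dWaveSourceTorusTT' L tp U μ h₀).IsHermitian := dWaveSourceTorusTT'_isHermitian L tp U μ h₀
  have hS : (dWaveSourceTorusTT' L tp U μ h).IsHermitian := dWaveSourceTorusTT'_isHermitian L tp U μ h
  have hH := ahmTT'_isHermitian_model L tp U μ h₀ g
  have hV : (0 : ℝ) < (L : ℝ) ^ 2 := cast_sq_pos_of_neZero L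
  have hlog4 : 0 < Real.log 4 := Real.log_pos (by norm_num)
  refine le_of_forall_pos_le_add fun κ hκ => ?_
  -- inverse temperature with entropy allowance `L² log 4 = κ (β - 1) < κ β`
  obtain ⟨β, hβdef⟩ : ∃ β : ℝ, β = (L : ℝ) ^ 2 * Real.log 4 / κ + 1 := ⟨_, rfl⟩
  have hβ : 0 < β := by rw [hβdef]; positivity
  have hK : (L : ℝ) ^ 2 * Real.log 4 = κ * (β - 1) := by rw [hβdef]; field_simp; ring
  have key := log_partitionFn_approx_le_model hT
    (((Real.sqrt g : ℝ) : ℂ) • pairField dWaveFormFactor L) hβ.le hV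
    (((h - h₀) / Real.sqrt g : ℝ) : ℂ)
  rw [ahmTT'_approx_real_eq L tp U μ h₀ h hg, ahmTT'_model_eq L _ hg.le, Complex.norm_real,
    Real.norm_eq_abs, sq_abs, div_pow, Real.sq_sqrt hg.le] at key
  have hsw := t0AHM_groundEnergy_sandwich hS hH hβ.le
    (a := -(β * (L : ℝ) ^ 2 * ((h - h₀) ^ 2 / g))) (b := 0) (by linarith only [key])
  rw [log_card_fock] at hsw
  refine le_of_mul_le_mul_left ?_ hβ
  have hβκ : 0 ≤ β * κ := by positivity
  have e1 : β * ((dWaveSourceTorusTT' L tp U μ h).groundEnergy +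
        (h - h₀) ^ 2 * (L : ℝ) ^ 2 / g + κ) =
      β * (dWaveSourceTorusTT' L tp U μ h).groundEnergy +
        β * (L : ℝ) ^ 2 * ((h - h₀) ^ 2 / g) + κ * β := by
    ring
  rw [e1]
  linarith

end PerTorus

end Summit.Ventures.CertifiedManyBodySolver.Observables.SourcedTorusAHM

end
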